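import Summits.QuantumFields.BalabanUV.T4Continuum.Support.ShellMeasureAverageIteratePower
import Summits.QuantumFields.BalabanUV.T4Continuum.Support.ShellMeasureAverageIterateRegular

/-!
# `T4Continuum.ShellMeasureAverageIterateEnd` — row S57 × row S59: [B7] PROP. 6 (164) SHAPE FOR THE (15) AVERAGE FROM
# PRINT'S (52) ALONE — the `k`-fold chart iterate is analytic ∕ `0` at `0` ∕ linearly bounded, the ITERATE IDENTITY
# `\overline{V′U₀}ᵏ(c) = exp(i·Q_k(B)(c))·Ū₀ᵏ(c)` and `‖\overline{V′U₀}ᵏ(c)(Ū₀ᵏ(c))⁻¹ − 1‖ ≤ e^{Mᵏ‖B‖} − 1` hold on the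
# pyramid for EVERY configuration `U₀` with values in an averaging-closed gauge group (e.g. `U(N)`) satisfying (52)
# `pdev U₀ < α₀(Lᵏ)⁻²`, `C₀α₀ ≤ ⅓`, `2α₀ ≤ c₂′` — the per-level regime binders of `ShellMeasureAverageIterate(Power)` DISCHARGED
# by leaf-04-g4's `ShellMeasureAverageIterateRegular` ([B7] Props 1–2 transported to (15)) (cell `pub-balaban`, sub-cell
# `t4`, spine estimate NE7c (node U5b); NE7c ROUND-2 crew `t4-ne7c-formalise-*`, unit `b2b-balaban-t4-ne7c-formalise-leaf-06`
# gen 3, row S57 file 3 = the junction leaf-04-g4 asked for (journal l.14247 «→ leaf-06-g3: … feed `chartIter_facts` with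
# `norm_level_le_one`∕`norm_level_inv_le_one`∕`loop_level_le_const`»); ADDITIVE — imports this row's f2
# `ShellMeasureAverageIteratePower` (p219676) and S59 `ShellMeasureAverageIterateRegular` (p219864) ONLY; [folklore]; 0 def,
# 0 sorry, 0 cite tags)

HONEST FRAMING.  Finite four-torus programme, rung (B)+1 only — NOT infinite volume, NOT a mass gap, NOT the Clay
problem, NOT summit progress.  NE7c is NOT PRINTED and NOT PROVED; «NE7c ⇐ the named binders».  WHAT REMAINS DISPLAYED
after this file, of [Balaban1985Averaging] Prop. 6's hypotheses∕conclusion for the (15) average: (i) the chart radius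
`M⁻¹M⁻ᵏ`, `M = 2816(d+1)L`, still SHRINKS in `k` (print: a `k`-UNIFORM `|A′| < α₁`, via Prop. 3's sharp linear part —
rows S55∕S56); (ii) corner cubes on `ℤᵈ` (D-b12g20.1), an `AvgClosed` gauge group (`U(N)`; not a proper subgroup such as
`SU(N)`, b07 D-b07g14.1 (b)); (iii) for Bałaban's MINIMISERS the regularity (52) itself is the W-a-type binder (B11 (19)–(21)).
Print's (52) is consumed through b07's kernel-checked Proposition 2 (`B7Prop2Explicit`), BY NAME via S59; nothing printed is
asserted here.  HONEST DEPENDENCY (cell): continuum YM on T⁴ ⇐ BetaPertH ∧ nine spine estimates (0/9 proved); BetaPertH ⇐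
(D1) ∧ (D4) ∧ CAP+tail; G-an2-4 gates asym, D1 and NE2/3/4.

## What is proved (all [folklore])

* §1 LEVEL-BOUNDED VARIANTS of files 1–2 (their hypotheses were asked at EVERY level `j`; (52) delivers them for `j ≤ k`
  only): `iterMap_facts_of_lt` (file 1 §1 with `∀ j < k`), `chartIter_facts_of_lt`, `avgIter_pert_eq_of_lt`,
  `norm_avgIter_quot_sub_one_le_of_lt` — same proofs, hypotheses at the levels `j < k` actually used.
* §2 THE END FROM (52): `avgIter_eq_uncurry` (this row's `avgIter` IS b07's `Ū₀ʲ` uncurried — S59's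
  `iterate_eq_uncurry_avgIter`), **`chartIter_analyticOnNhd_of_prop2`**, **`norm_chartIter_le_of_prop2`**,
  **`avgIter_pert_eq_of_prop2`**, **`norm_avgIter_quot_sub_one_le_of_prop2`** — hypotheses: `2 ≤ L`, the pyramid `hT`,
  `U₀` valued in an `AvgClosed` group `G`, `0 < α₀`, `C₀α₀ ≤ ⅓`, `2α₀ ≤ c₂′(d,L)`, (52) `pdev U₀ < α₀(Lᵏ)⁻²` — NO regime binder;
  `…_unitary` — the same for the unitary group of a non-trivial C⋆-algebra (`M_N(ℂ)`, `U(N)`).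
-/

noncomputable section

open NormedSpace Metric Set

namespace Summit.QuantumFields.BalabanUV.T4Continuum.ShellMeasureAverageIterateEnd

open Literature.MathematicalPhysics.QuantumFieldTheory.Balaban1983to89
open Literature.MathematicalPhysics.QuantumLattice (ZdEdge)
open B7BlockGeometry (qppBonds)
open B7Prop2Explicit (pdev C0 c2' AvgClosed unitaryUnits avgClosed_unitaryUnits)
open B12HOperator267 (gammaT)
open B12AverageCorridor267 (expU val_expU pert pert_apply avgM avgM_congr isBlockLocal_gammaT loopW offAxis)
open Literature.Analysis.Calculus (norm_exp_sub_one_le)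
open ShellMeasureAverageAnalyticB7 (extend_val)
open ShellMeasureAverageIterate (iterMap iterMap_zero iterMap_succ ext ext_apply_mem restr restr_apply norm_restr_le
  Qtilde_ext_eq_of_subset chartStep chartStep_zero chartStep_analyticOnNhd norm_chartStep_le chartIter chartIter_zero_apply
  chartIter_succ_apply)
open ShellMeasureAverageIteratePower (avgIter avgIter_zero avgIter_succ avgM_pert_eq_exp_mul)
open ShellMeasureAverageIterateRegular (iterate_eq_uncurry_avgIter norm_level_le_one norm_level_inv_le_one
  loop_level_le_const)

/-! ## §1 Level-bounded variants -/

section Generic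

variable {E : ℕ → Type*} [∀ j, NormedAddCommGroup (E j)] [∀ j, NormedSpace ℂ (E j)]

/-- File 1's `iterMap_facts` with the hypotheses asked at the levels `j < k` only. [folklore] -/
theorem iterMap_facts_of_lt (F : ∀ j, E j → E (j + 1)) {r M : ℝ} (hr : 0 < r) (hM : 1 ≤ M) (k : ℕ)
    (hF : ∀ j < k, AnalyticOnNhd ℂ (F j) (ball 0 r)) (h0 : ∀ j < k, F j 0 = 0)
    (hb : ∀ j < k, ∀ B ∈ ball (0 : E j) r, ‖F j B‖ ≤ M * ‖B‖) :
    AnalyticOnNhd ℂ (iterMap F k) (ball 0 (r / M ^ k)) ∧ iterMap F k 0 = 0 ∧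
      ∀ B ∈ ball (0 : E 0) (r / M ^ k), ‖iterMap F k B‖ ≤ M ^ k * ‖B‖ := by
  have hM0 : 0 < M := lt_of_lt_of_le one_pos hM
  induction k with
  | zero =>
    refine ⟨fun B _ => ?_, rfl, fun B _ => by rw [iterMap_zero, pow_zero, one_mul]⟩
    exact analyticAt_id
  | succ k ih =>
    obtain ⟨ihA, ih0, ihb⟩ := ih (fun j hj => hF j (Nat.lt_succ_of_lt hj)) (fun j hj => h0 j (Nat.lt_succ_of_lt hj))
      (fun j hj => hb j (Nat.lt_succ_of_lt hj))
    have hk : k < k + 1 := Nat.lt_succ_self k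
    have hpow : 0 < M ^ k := pow_pos hM0 k
    have hsub : ∀ B ∈ ball (0 : E 0) (r / M ^ (k + 1)), B ∈ ball (0 : E 0) (r / M ^ k) := fun B hB => by
      rw [mem_ball_zero_iff] at hB ⊢
      refine hB.trans_le (div_le_div_of_nonneg_left hr.le hpow ?_)
      rw [pow_succ]
      exact le_mul_of_one_le_right hpow.le hM
    have himg : ∀ B ∈ ball (0 : E 0) (r / M ^ (k + 1)), iterMap F k B ∈ ball (0 : E k) r := fun B hB => by
      have hB' := ihb B (hsub B hB)
      rw [mem_ball_zero_iff] at hB ⊢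
      calc ‖iterMap F k B‖ ≤ M ^ k * ‖B‖ := hB'
        _ < M ^ k * (r / M ^ (k + 1)) := mul_lt_mul_of_pos_left hB hpow
        _ = r / M := by rw [pow_succ]; field_simp
        _ ≤ r := div_le_self hr.le hM
    refine ⟨fun B hB => ?_, by rw [iterMap_succ, ih0, h0 k hk], fun B hB => ?_⟩
    · exact (hF k hk _ (himg B hB)).comp (ihA B (hsub B hB))
    · rw [iterMap_succ]
      calc ‖F k (iterMap F k B)‖ ≤ M * ‖iterMap F k B‖ := hb k hk _ (himg B hB)
        _ ≤ M * (M ^ k * ‖B‖) := mul_le_mul_of_nonneg_left (ihb B (hsub B hB)) hM0.le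
        _ = M ^ (k + 1) * ‖B‖ := by rw [pow_succ]; ring

end Generic

section Bounded

variable {d : ℕ} {𝔸 : Type*} [NormedRing 𝔸] [NormedAlgebra ℂ 𝔸] [CompleteSpace 𝔸] [NormOneClass 𝔸] {L : ℕ}
  {T : ℕ → Finset (ZdEdge d)} {V : ℕ → ZdEdge d → 𝔸ˣ}
  (hL : 0 < L) (hT : ∀ j, ∀ c ∈ T (j + 1), qppBonds L c ⊆ T j) (k : ℕ)
  (hV : ∀ j < k, ∀ b, ‖((V j b : 𝔸ˣ) : 𝔸)‖ ≤ 1) (hV' : ∀ j < k, ∀ b, ‖(((V j b)⁻¹ : 𝔸ˣ) : 𝔸)‖ ≤ 1)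
  {ε : ℝ} (hε0 : 0 ≤ ε) (hε : ε ≤ 1 / 8)
  (hW : ∀ j < k, ∀ c : ZdEdge d, ∀ x ∈ offAxis L c,
    ‖((loopW L (fun U : ZdEdge d → 𝔸ˣ => gammaT L U) (V j) c x : 𝔸ˣ) : 𝔸) - 1‖ ≤ ε)
include hL hT hV hV' hε0 hε hW

/-- File 1's `chartIter_facts` with the regime binders asked at the levels `j < k` only (each level's chart map only reads
`V j`: file 1's `chartStep_analyticOnNhd`∕`norm_chartStep_le` at the constant family `fun _ => V j`). [folklore] -/
theorem chartIter_facts_of_lt :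
    AnalyticOnNhd ℂ (chartIter L T V k)
        (ball 0 (1 / (2816 * ((d : ℝ) + 1) * L) / (2816 * ((d : ℝ) + 1) * L) ^ k)) ∧
      chartIter L T V k 0 = 0 ∧
      ∀ B ∈ ball (0 : ↥(T 0) → 𝔸) (1 / (2816 * ((d : ℝ) + 1) * L) / (2816 * ((d : ℝ) + 1) * L) ^ k),
        ‖chartIter L T V k B‖ ≤ (2816 * ((d : ℝ) + 1) * L) ^ k * ‖B‖ := by
  have hLr : (1 : ℝ) ≤ L := by exact_mod_cast hL
  have hM : (1 : ℝ) ≤ 2816 * ((d : ℝ) + 1) * L := by nlinarith [(Nat.cast_nonneg d : (0 : ℝ) ≤ d)]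
  refine iterMap_facts_of_lt (E := fun j => ↥(T j) → 𝔸) (chartStep L T V) (by positivity) hM k ?_
    (fun j _ => chartStep_zero j) ?_
  · intro j hj
    exact chartStep_analyticOnNhd (V := fun _ => V j) hL hT (fun _ => hV j hj) (fun _ => hV' j hj) hε0 hε
      (fun _ c _ => hW j hj c) j
  · intro j hj B hB
    exact norm_chartStep_le (V := fun _ => V j) hL hT (fun _ => hV j hj) (fun _ => hV' j hj) hε0 hε
      (fun _ c _ => hW j hj c) j hB

end Bounded

section BoundedIdentity

variable {d : ℕ} {𝔸 : Type*} [NormedRing 𝔸] [NormedAlgebra ℂ 𝔸] [CompleteSpace 𝔸] [NormOneClass 𝔸] {L : ℕ}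
  {T : ℕ → Finset (ZdEdge d)} {U₀ : ZdEdge d → 𝔸ˣ}
  (hL : 0 < L) (hT : ∀ j, ∀ c ∈ T (j + 1), qppBonds L c ⊆ T j) (k : ℕ)
  (hV : ∀ j < k, ∀ b, ‖((avgIter L U₀ j b : 𝔸ˣ) : 𝔸)‖ ≤ 1)
  (hV' : ∀ j < k, ∀ b, ‖(((avgIter L U₀ j b)⁻¹ : 𝔸ˣ) : 𝔸)‖ ≤ 1)
  {ε : ℝ} (hε0 : 0 ≤ ε) (hε : ε ≤ 1 / 8)
  (hW : ∀ j < k, ∀ c : ZdEdge d, ∀ x ∈ offAxis L c,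
    ‖((loopW L (fun U : ZdEdge d → 𝔸ˣ => gammaT L U) (avgIter L U₀ j) c x : 𝔸ˣ) : 𝔸) - 1‖ ≤ ε)
include hL hT hV hV' hε0 hε hW

/-- File 2's ITERATE IDENTITY with the regime binders asked at the levels `j < k` only (induction on `n ≤ k`). [folklore] -/
theorem avgIter_pert_eq_of_lt {n : ℕ} (hn : n ≤ k) {B : ↥(T 0) → 𝔸}
    (hB : B ∈ ball (0 : ↥(T 0) → 𝔸) (1 / (2816 * ((d : ℝ) + 1) * L) / (2816 * ((d : ℝ) + 1) * L) ^ n))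
    {c : ZdEdge d} (hc : c ∈ T n) :
    avgIter L (pert (ext (T 0) B) U₀) n c
      = pert (ext (T n) (chartIter L T (avgIter L U₀) n B)) (avgIter L U₀ n) c := by
  have hLr : (1 : ℝ) ≤ L := by exact_mod_cast hL
  have hM1 : (1 : ℝ) ≤ 2816 * ((d : ℝ) + 1) * L := by nlinarith [(Nat.cast_nonneg d : (0 : ℝ) ≤ d)]
  have hM0 : (0 : ℝ) < 2816 * ((d : ℝ) + 1) * L := lt_of_lt_of_le one_pos hM1
  have hr0 : (0 : ℝ) < 1 / (2816 * ((d : ℝ) + 1) * L) := by positivity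
  induction n generalizing c with
  | zero =>
    rw [avgIter_zero, avgIter_zero, chartIter_zero_apply]
  | succ n ih =>
    have hnk : n < k := Nat.lt_of_succ_le hn
    have hn' : n ≤ k := hnk.le
    have hpow : (0 : ℝ) < (2816 * ((d : ℝ) + 1) * L) ^ n := pow_pos hM0 n
    have hBn : B ∈ ball (0 : ↥(T 0) → 𝔸) (1 / (2816 * ((d : ℝ) + 1) * L) / (2816 * ((d : ℝ) + 1) * L) ^ n) := by
      rw [mem_ball_zero_iff] at hB ⊢
      refine hB.trans_le (div_le_div_of_nonneg_left hr0.le hpow ?_)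
      rw [pow_succ]
      exact le_mul_of_one_le_right hpow.le hM1
    -- the level-`n` chart iterate restricted to `B(c₋) ∪ B(c₊)` lies in the one-step ball
    have hfacts := chartIter_facts_of_lt hL hT k hV hV' hε0 hε hW
    have hQn : ‖restr (hT n c hc) (chartIter L T (avgIter L U₀) n B)‖ < 1 / (2816 * ((d : ℝ) + 1) * L) := by
      refine (norm_restr_le _ _).trans_lt ?_
      -- bound at level `n` from the level-`n` facts (the hypotheses for `j < n` are among those for `j < k`)
      have hb := (chartIter_facts_of_lt hL hT n (fun j hj => hV j (hj.trans hnk)) (fun j hj => hV' j (hj.trans hnk))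
        hε0 hε (fun j hj => hW j (hj.trans hnk))).2.2 B hBn
      rw [mem_ball_zero_iff] at hB
      calc ‖chartIter L T (avgIter L U₀) n B‖ ≤ (2816 * ((d : ℝ) + 1) * L) ^ n * ‖B‖ := hb
        _ < (2816 * ((d : ℝ) + 1) * L) ^ n *
              (1 / (2816 * ((d : ℝ) + 1) * L) / (2816 * ((d : ℝ) + 1) * L) ^ (n + 1)) :=
            mul_lt_mul_of_pos_left hB hpow
        _ = 1 / (2816 * ((d : ℝ) + 1) * L) / (2816 * ((d : ℝ) + 1) * L) := by rw [pow_succ]; field_simp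
        _ ≤ 1 / (2816 * ((d : ℝ) + 1) * L) := div_le_self hr0.le hM1
    clear hfacts
    have hagree : ∀ b ∈ qppBonds L c, avgIter L (pert (ext (T 0) B) U₀) n b =
        pert (Function.extend Subtype.val (restr (hT n c hc) (chartIter L T (avgIter L U₀) n B)) (0 : ZdEdge d → 𝔸))
          (avgIter L U₀ n) b := fun b hb => by
      rw [ih hn' hBn (hT n c hc hb), pert_apply, pert_apply, ext_apply_mem _ (hT n c hc hb), extend_val _ ⟨b, hb⟩,
        restr_apply]
    apply Units.ext
    rw [avgIter_succ, avgM_congr hL (isBlockLocal_gammaT hL) hagree,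
      avgM_pert_eq_exp_mul hL (hV n hnk) (hV' n hnk) hε0 hε (hW n hnk c) hQn, pert_apply, Units.val_mul, val_expU,
      avgIter_succ, ext_apply_mem _ hc, chartIter_succ_apply]
    congr 2
    exact congrArg _ (Qtilde_ext_eq_of_subset hL (hT n c hc) (avgIter L U₀ n) (chartIter L T (avgIter L U₀) n B)).symm

/-- File 2's (164) SHAPE with the regime binders asked at the levels `j < k` only. [folklore] -/
theorem norm_avgIter_quot_sub_one_le_of_lt {B : ↥(T 0) → 𝔸}
    (hB : B ∈ ball (0 : ↥(T 0) → 𝔸) (1 / (2816 * ((d : ℝ) + 1) * L) / (2816 * ((d : ℝ) + 1) * L) ^ k))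
    {c : ZdEdge d} (hc : c ∈ T k) :
    ‖((avgIter L (pert (ext (T 0) B) U₀) k c * (avgIter L U₀ k c)⁻¹ : 𝔸ˣ) : 𝔸) - 1‖
      ≤ Real.exp ((2816 * ((d : ℝ) + 1) * L) ^ k * ‖B‖) - 1 := by
  rw [avgIter_pert_eq_of_lt hL hT k hV hV' hε0 hε hW le_rfl hB hc, pert_apply, mul_inv_cancel_right, val_expU]
  refine (norm_exp_sub_one_le _).trans ?_
  rw [norm_smul, Complex.norm_I, one_mul, ext_apply_mem _ hc]
  exact sub_le_sub_right (Real.exp_le_exp.2 ((norm_le_pi_norm _ _).trans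
    ((chartIter_facts_of_lt hL hT k hV hV' hε0 hε hW).2.2 B hB))) 1

end BoundedIdentity

/-! ## §2 The END from print's (52) -/

section Prop2

variable {d : ℕ} {𝔸 : Type*} [NormedRing 𝔸] [NormOneClass 𝔸] [NormedAlgebra ℂ 𝔸] [CompleteSpace 𝔸] {L : ℕ}
  {T : ℕ → Finset (ZdEdge d)}

omit [NormOneClass 𝔸] in
/-- THIS ROW'S `avgIter` IS b07's `k`-FOLD AVERAGE `Ū₀ʲ`, UNCURRIED (S59's `iterate_eq_uncurry_avgIter` applied to the
b12-side recursion `avgIter_zero`∕`avgIter_succ`). [folklore] -/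
theorem avgIter_eq_uncurry (hL : 0 < L) (U : ZdEdge d → 𝔸ˣ) (j : ℕ) :
    avgIter L U j = Function.uncurry (B7Prop2Explicit.avgIter L (Function.curry U) j) :=
  iterate_eq_uncurry_avgIter hL (fun j U => avgIter L U j) (fun U => avgIter_zero U) (fun j U c => avgIter_succ U j c) U j

variable (hL : 2 ≤ L) (hT : ∀ j, ∀ c ∈ T (j + 1), qppBonds L c ⊆ T j) {G : Subgroup 𝔸ˣ} (hG : AvgClosed d L G)
  (k : ℕ) (U₀ : ZdEdge d → 𝔸ˣ) (hU : ∀ b, U₀ b ∈ G) {α₀ : ℝ} (hα : 0 < α₀) (hα3 : C0 d * α₀ ≤ 1 / 3)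
  (hα2 : 2 * α₀ ≤ c2' d L) (h52 : pdev (Function.curry U₀) < α₀ * (((L : ℝ) ^ k)⁻¹) ^ 2)
include hL hT hG hU hα hα3 hα2 h52

omit hT in
/-- the three regime binders of files 1–2 for the averaged backgrounds `avgIter L U₀ j`, `j < k`, FROM (52) (S59 §2,
`ε = 1∕32`). [folklore] -/
theorem regime_of_prop2 :
    (∀ j < k, ∀ b, ‖((avgIter L U₀ j b : 𝔸ˣ) : 𝔸)‖ ≤ 1) ∧
      (∀ j < k, ∀ b, ‖(((avgIter L U₀ j b)⁻¹ : 𝔸ˣ) : 𝔸)‖ ≤ 1) ∧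
      ∀ j < k, ∀ c : ZdEdge d, ∀ x ∈ offAxis L c,
        ‖((loopW L (fun U : ZdEdge d → 𝔸ˣ => gammaT L U) (avgIter L U₀ j) c x : 𝔸ˣ) : 𝔸) - 1‖ ≤ 1 / 32 := by
  have hL0 : 0 < L := lt_of_lt_of_le (by norm_num) hL
  refine ⟨fun j hj b => ?_, fun j hj b => ?_, fun j hj c x hx => ?_⟩
  · rw [avgIter_eq_uncurry hL0]
    exact norm_level_le_one hL hG k U₀ hU hα hα3 hα2 h52 hj.le b
  · rw [avgIter_eq_uncurry hL0]
    exact norm_level_inv_le_one hL hG k U₀ hU hα hα3 hα2 h52 hj.le b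
  · rw [avgIter_eq_uncurry hL0]
    exact loop_level_le_const hL hG k U₀ hU hα hα3 hα2 h52 hj.le c hx

/-- **THE `k`-FOLD CHART ITERATE OVER THE AVERAGED BACKGROUNDS `Ū₀ʲ` IS ANALYTIC on `ball 0 (M⁻¹∕Mᵏ)`, `M = 2816(d+1)L`,
FROM (52) ALONE** (no regime binder). [folklore] -/
theorem chartIter_analyticOnNhd_of_prop2 :
    AnalyticOnNhd ℂ (chartIter L T (avgIter L U₀) k)
      (ball 0 (1 / (2816 * ((d : ℝ) + 1) * L) / (2816 * ((d : ℝ) + 1) * L) ^ k)) := by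
  obtain ⟨hV, hV', hW⟩ := regime_of_prop2 hL hG k U₀ hU hα hα3 hα2 h52
  exact (chartIter_facts_of_lt (lt_of_lt_of_le (by norm_num) hL) hT k hV hV' (by norm_num) (by norm_num) hW).1

/-- **… AND LINEARLY BOUNDED THERE, FROM (52) ALONE.** [folklore] -/
theorem norm_chartIter_le_of_prop2 {B : ↥(T 0) → 𝔸}
    (hB : B ∈ ball (0 : ↥(T 0) → 𝔸) (1 / (2816 * ((d : ℝ) + 1) * L) / (2816 * ((d : ℝ) + 1) * L) ^ k)) :
    ‖chartIter L T (avgIter L U₀) k B‖ ≤ (2816 * ((d : ℝ) + 1) * L) ^ k * ‖B‖ := by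
  obtain ⟨hV, hV', hW⟩ := regime_of_prop2 hL hG k U₀ hU hα hα3 hα2 h52
  exact (chartIter_facts_of_lt (lt_of_lt_of_le (by norm_num) hL) hT k hV hV' (by norm_num) (by norm_num) hW).2.2 B hB

/-- **THE ITERATE IDENTITY FROM (52) ALONE** ([B7] Prop. 6's `\overline{U′U₀}ᵏ = Ũ′ᵏ·Ū₀ᵏ` SHAPE for (15)): for `U₀`
valued in an averaging-closed gauge group with (52), `‖B‖ < M⁻¹∕Mᵏ` and `c ∈ T k`,
`avgIter L (pert (ext B) U₀) k c = pert (ext (chartIter k B)) (avgIter L U₀ k) c`. [folklore] -/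
theorem avgIter_pert_eq_of_prop2 {B : ↥(T 0) → 𝔸}
    (hB : B ∈ ball (0 : ↥(T 0) → 𝔸) (1 / (2816 * ((d : ℝ) + 1) * L) / (2816 * ((d : ℝ) + 1) * L) ^ k))
    {c : ZdEdge d} (hc : c ∈ T k) :
    avgIter L (pert (ext (T 0) B) U₀) k c
      = pert (ext (T k) (chartIter L T (avgIter L U₀) k B)) (avgIter L U₀ k) c := by
  obtain ⟨hV, hV', hW⟩ := regime_of_prop2 hL hG k U₀ hU hα hα3 hα2 h52
  exact avgIter_pert_eq_of_lt (lt_of_lt_of_le (by norm_num) hL) hT k hV hV' (by norm_num) (by norm_num) hW le_rfl hB hc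

/-- **(164) SHAPE FROM (52) ALONE**: `‖\overline{V′U₀}ᵏ(c)·(Ū₀ᵏ(c))⁻¹ − 1‖ ≤ e^{Mᵏ‖B‖} − 1` there. [folklore] -/
theorem norm_avgIter_quot_sub_one_le_of_prop2 {B : ↥(T 0) → 𝔸}
    (hB : B ∈ ball (0 : ↥(T 0) → 𝔸) (1 / (2816 * ((d : ℝ) + 1) * L) / (2816 * ((d : ℝ) + 1) * L) ^ k))
    {c : ZdEdge d} (hc : c ∈ T k) :
    ‖((avgIter L (pert (ext (T 0) B) U₀) k c * (avgIter L U₀ k c)⁻¹ : 𝔸ˣ) : 𝔸) - 1‖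
      ≤ Real.exp ((2816 * ((d : ℝ) + 1) * L) ^ k * ‖B‖) - 1 := by
  obtain ⟨hV, hV', hW⟩ := regime_of_prop2 hL hG k U₀ hU hα hα3 hα2 h52
  exact norm_avgIter_quot_sub_one_le_of_lt (lt_of_lt_of_le (by norm_num) hL) hT k hV hV' (by norm_num) (by norm_num)
    hW hB hc

end Prop2

/-! ## §3 The printed gauge group: unitary-valued configurations (`U(N)`, `M_N(ℂ)` with the operator norm) -/

section Unitary

variable {d : ℕ} {𝔸 : Type*} [CStarAlgebra 𝔸] [Nontrivial 𝔸] {L : ℕ} {T : ℕ → Finset (ZdEdge d)}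

/-- **THE ITERATE IDENTITY AND THE (164) SHAPE FOR UNITARY-VALUED REGULAR CONFIGURATIONS** (print's setting: `U(N)`-valued
`U₀` with (52), `C₀α₀ ≤ ⅓`, `2α₀ ≤ c₂′`; `B7Prop2Explicit.avgClosed_unitaryUnits`), for `‖B‖ < M⁻¹∕Mᵏ`, `c ∈ T k`.
[folklore] -/
theorem avgIter_pert_eq_unitary (hL : 2 ≤ L) (hT : ∀ j, ∀ c ∈ T (j + 1), qppBonds L c ⊆ T j) (k : ℕ)
    (U₀ : ZdEdge d → 𝔸ˣ) (hU : ∀ b, U₀ b ∈ unitaryUnits 𝔸) {α₀ : ℝ} (hα : 0 < α₀) (hα3 : C0 d * α₀ ≤ 1 / 3)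
    (hα2 : 2 * α₀ ≤ c2' d L) (h52 : pdev (Function.curry U₀) < α₀ * (((L : ℝ) ^ k)⁻¹) ^ 2) {B : ↥(T 0) → 𝔸}
    (hB : B ∈ ball (0 : ↥(T 0) → 𝔸) (1 / (2816 * ((d : ℝ) + 1) * L) / (2816 * ((d : ℝ) + 1) * L) ^ k))
    {c : ZdEdge d} (hc : c ∈ T k) :
    avgIter L (pert (ext (T 0) B) U₀) k c
        = pert (ext (T k) (chartIter L T (avgIter L U₀) k B)) (avgIter L U₀ k) c ∧
      ‖((avgIter L (pert (ext (T 0) B) U₀) k c * (avgIter L U₀ k c)⁻¹ : 𝔸ˣ) : 𝔸) - 1‖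
        ≤ Real.exp ((2816 * ((d : ℝ) + 1) * L) ^ k * ‖B‖) - 1 :=
  ⟨avgIter_pert_eq_of_prop2 hL hT (avgClosed_unitaryUnits d L) k U₀ hU hα hα3 hα2 h52 hB hc,
    norm_avgIter_quot_sub_one_le_of_prop2 hL hT (avgClosed_unitaryUnits d L) k U₀ hU hα hα3 hα2 h52 hB hc⟩

end Unitary

end Summit.QuantumFields.BalabanUV.T4Continuum.ShellMeasureAverageIterateEnd

end
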